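import Summits.SmoothPoincare4.SmoothPoincare4.Theses.ThreeFibres
import Literature.Topology.FourManifolds.GluckTwist
import HarnessLib
import HarnessLib.Audit

/-!
# Birth skeleton (BC3) for crux `ThreeFibres.StabOneSuffices` (item stmt-SmoothPoincare4-13902)

Line `birth` — the GLUCK SPLIT of "one stabilisation suffices" (S1).

S1 (the crux, verbatim the route decl `Summit.SmoothPoincare4.SmoothPoincare4.Theses.ThreeFibres.StabOneSuffices`,
shared with route OneStabInvertible and ⇔ Stabilisation's stmt-SmoothPoincare4-0386): every smooth homotopy
4-sphere `M` (bare binders of `SmoothPoincare4`: Hausdorff, second countable, `C^∞` atlas on `𝓡 4`,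
`e : M ≃ₕ S⁴`) has SOME connected sum `M # (S²×S²)` diffeomorphic to `S²×S²`.

The line factors S1 through the Gluck-twist presentation of homotopy 4-spheres, using ONLY tree vocabulary
(`Literature.Topology.FourManifolds.IsGluckTwist`, `TwoKnot`, `IsConnectedSum`):

* STUB 1 `stub_gluckPresentation` — EVERY HOMOTOPY 4-SPHERE IS A GLUCK TWIST: for every such `M` there is a
  2-knot `K : S² ↪ S⁴` with `IsGluckTwist (𝓡 4) M K` (relational: `M` is the open gluing of `S⁴ ∖ K` and
  `S² × ℝ²` along Gluck's map `τ`). OPEN (implied by `SmoothPoincare4` through the tree's named fact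
  `isGluckTwist_sphere_unknotTwo` + transport; converse direction = the Gluck twist conjecture, Kirby 4.24 / 4.11,
  open). It is NOT the crux: it says nothing about stabilisation, and S1 does not give it by any known theorem.
* STUB 2 `stub_gluckOneStab` — GLUCK TWISTS DISSOLVE AFTER ONE `S²×S²` (Stern's k = 1 problem RESTRICTED to Gluck
  twists): every Gluck twist `X` of `S⁴` satisfies the conclusion of S1. OPEN: the `ℂP²` version is a tree
  THEOREM (`exists_isConnectedSum_complexProjectivePlane_of_isGluckTwist`, GompfStipsicz1999 Ex. 5.2.7(b),
  AkbulutYasui2013 Cor. 1.3), hence also the `S² ×~ S² = ℂP² # ℂP²bar` version; the `S²×S²` (spin) version is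
  exactly what is not in print (route docstrings of ThreeFibres #3 / OneStabInvertible #4). It is NOT the crux:
  it quantifies over Gluck twists only, and reaches all homotopy spheres only through STUB 1.

COMPOSITION (kernel-checked, no `sorry` outside the two stubs): `stabOneSuffices_of_stubs : <stub₁-sig> →
<stub₂-sig> → <the crux statement>` (3 tactic lines: take `M, e`; STUB 1 gives `K` with `IsGluckTwist (𝓡 4) M K`;
STUB 2 at `(K, M)` is the goal) and THE skeleton theorem `StabOneSuffices_of : ThreeFibres.StabOneSuffices :=
stabOneSuffices_of_stubs stub_gluckPresentation stub_gluckOneStab` — the crux BY NAME, closed modulo the two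
registered stubs (D-0027 §3.3 shape `<Crux>_proof := crux_of stub₁_holds stub₂_holds`). It is deliberately the
ONLY theorem of the file whose conclusion is the crux constant, so `#h21_check_skeleton` audits exactly it (an
arrow-form theorem with the stub statements as anonymous hypotheses would be flagged `skeleton.extra-hypothesis`,
and naming them needs the gate-reserved stub attribute); the arrow form `<stub₁-sig> → <stub₂-sig> →
StabOneSuffices` is certified by the closing `example`.

DISPROOF USED: no `Disproof.lean` exists for this crux yet (`ledger crux ls stmt-SmoothPoincare4-13902`: no
workfiles, 2026-08-17); negatives index for SmoothPoincare4: see NOTES. Refuter evidence on the item (ATTACK.md,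
W0.lean, 2026-08-15): the crux survives elaboration / triviality / vacuity / mutation probes; `e` cannot be
dropped (empty carrier) — both stubs keep `e` resp. the Gluck-twist hypothesis, so neither is vacuous-by-junk:
a Gluck twist is nonempty (`IsGluckTwist.nonempty`) and S⁴ itself is one (unknot).

BARRIERS: `Literature.Barriers.SmoothPoincare4.OneStabilisationBarrier` (Kang 2022: one `S²×S²` does not undo
every cork) concerns contractible 4-manifolds WITH BOUNDARY; STUB 2 is about closed Gluck twists, where Kang's
Question 1 is open — conceded, not evaded. `GluckTwistCP2Barrier` (ℂP²-dissolution kills every ℂP²-stable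
invariant on Gluck twists) is the reason STUB 2 cannot be settled NEGATIVELY by stable invariants; it does not
obstruct a positive proof.
-/

noncomputable section

open scoped Manifold ContDiff Topology
open Literature.Topology.FourManifolds

namespace Summit.SmoothPoincare4.SmoothPoincare4.Cruxes.StabOneSuffices.Birth

set_option linter.dupNamespace false
set_option linter.unusedVariables false

/-- Local notation: the round 2-sphere `S² ⊂ ℝ³` (Mathlib manifold structure, model `𝓡 2`). -/
local notation "S²" => (Metric.sphere (0 : EuclideanSpace ℝ (Fin 3)) 1)

/-- Local notation: the round 4-sphere `S⁴ ⊂ ℝ⁵` (model `𝓡 4`). -/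
local notation "S⁴" => (Metric.sphere (0 : EuclideanSpace ℝ (Fin 5)) 1)

/-! ## The two registered stubs (`sorry` lives ONLY here; signatures spelled out over tree declarations) -/

/-- STUB 1 (registered) — EVERY HOMOTOPY 4-SPHERE IS A GLUCK TWIST: for every smooth homotopy 4-sphere `M`
(bare binders of `SmoothPoincare4` / of the crux: Hausdorff, second countable, `C^∞` on `𝓡 4`, `e : M ≃ₕ S⁴`)
there is a 2-knot `K : S² ↪ S⁴` with `IsGluckTwist (𝓡 4) M K`. Size: open problem (the hardest stub; implied
by `SmoothPoincare4`; Kirby1997 Problems 4.11/4.24, Gluck1962 §17, GompfStipsicz1999 §6.2). -/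
theorem stub_gluckPresentation :
    ∀ (M : Type) [TopologicalSpace M] [T2Space M] [SecondCountableTopology M]
      [ChartedSpace (EuclideanSpace ℝ (Fin 4)) M] [IsManifold (𝓡 4) ∞ M],
      ContinuousMap.HomotopyEquiv M S⁴ → ∃ K : TwoKnot, IsGluckTwist (𝓡 4) M K := by
  sorry

/-- STUB 2 (registered) — GLUCK TWISTS DISSOLVE AFTER ONE `S²×S²`: every Gluck twist `X` of `S⁴` (Hausdorff,
second countable, `C^∞` on `𝓡 4`) has some connected sum `X # (S²×S²)` (relational `IsConnectedSum`, sum on `𝓡 4`,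
`S²×S²` on `(𝓡 2).prod (𝓡 2)`) diffeomorphic to `S²×S²` — the conclusion of the crux, verbatim, at `X`. Size: open
problem (Stern's k = 1 restricted to Gluck twists; the `ℂP²` analogue is the tree THEOREM
`exists_isConnectedSum_complexProjectivePlane_of_isGluckTwist`, GompfStipsicz1999 Ex. 5.2.7(b), AkbulutYasui2013
Cor. 1.3; Kang2022OneStabilization Question 1). -/
theorem stub_gluckOneStab :
    ∀ (K : TwoKnot) (X : Type) [TopologicalSpace X] [T2Space X] [SecondCountableTopology X]
      [ChartedSpace (EuclideanSpace ℝ (Fin 4)) X] [IsManifold (𝓡 4) ∞ X],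
      IsGluckTwist (𝓡 4) X K →
        ∃ (P : Type) (_ : TopologicalSpace P) (_ : ChartedSpace (EuclideanSpace ℝ (Fin 4)) P)
          (_ : IsManifold (𝓡 4) ∞ P),
          IsConnectedSum (𝓡 4) (𝓡 4) ((𝓡 2).prod (𝓡 2)) X (S² × S²) P ∧
            Nonempty (P ≃ₘ⟮𝓡 4, (𝓡 2).prod (𝓡 2)⟯ (S² × S²)) := by
  sorry

/-! ## Composition: stubs ⟹ crux (no `sorry` below this line) -/

/-- **The Gluck split of S1, arrow form**: if every homotopy 4-sphere is a Gluck twist (STUB 1) and every Gluck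
twist dissolves after one `S²×S²` (STUB 2), then every homotopy 4-sphere dissolves after one `S²×S²` — the
statement of the crux `ThreeFibres.StabOneSuffices`, unfolded (so that this arrow theorem is not itself a
by-name candidate for the skeleton audit; the by-name theorem is `StabOneSuffices_of` below). -/
theorem stabOneSuffices_of_stubs
    (h₁ : ∀ (M : Type) [TopologicalSpace M] [T2Space M] [SecondCountableTopology M]
      [ChartedSpace (EuclideanSpace ℝ (Fin 4)) M] [IsManifold (𝓡 4) ∞ M],
      ContinuousMap.HomotopyEquiv M S⁴ → ∃ K : TwoKnot, IsGluckTwist (𝓡 4) M K)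
    (h₂ : ∀ (K : TwoKnot) (X : Type) [TopologicalSpace X] [T2Space X] [SecondCountableTopology X]
      [ChartedSpace (EuclideanSpace ℝ (Fin 4)) X] [IsManifold (𝓡 4) ∞ X],
      IsGluckTwist (𝓡 4) X K →
        ∃ (P : Type) (_ : TopologicalSpace P) (_ : ChartedSpace (EuclideanSpace ℝ (Fin 4)) P)
          (_ : IsManifold (𝓡 4) ∞ P),
          IsConnectedSum (𝓡 4) (𝓡 4) ((𝓡 2).prod (𝓡 2)) X (S² × S²) P ∧
            Nonempty (P ≃ₘ⟮𝓡 4, (𝓡 2).prod (𝓡 2)⟯ (S² × S²))) :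
    ∀ (M : Type) [TopologicalSpace M] [T2Space M] [SecondCountableTopology M]
      [ChartedSpace (EuclideanSpace ℝ (Fin 4)) M] [IsManifold (𝓡 4) ∞ M],
      ContinuousMap.HomotopyEquiv M S⁴ →
        ∃ (P : Type) (_ : TopologicalSpace P) (_ : ChartedSpace (EuclideanSpace ℝ (Fin 4)) P)
          (_ : IsManifold (𝓡 4) ∞ P),
          IsConnectedSum (𝓡 4) (𝓡 4) ((𝓡 2).prod (𝓡 2)) M (S² × S²) P ∧
            Nonempty (P ≃ₘ⟮𝓡 4, (𝓡 2).prod (𝓡 2)⟯ (S² × S²)) := by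
  intro M _ _ _ _ _ e
  obtain ⟨K, hK⟩ := h₁ M e
  exact h₂ K M hK

/-- **`StabOneSuffices_of` — THE SKELETON**: the crux `ThreeFibres.StabOneSuffices` BY NAME, closed modulo the
two registered stubs (D-0027 §3.3: `<Crux>_proof := crux_of stub₁_holds stub₂_holds`). Becomes the crux proof
when both stubs are discharged. -/
theorem StabOneSuffices_of :
    Summit.SmoothPoincare4.SmoothPoincare4.Theses.ThreeFibres.StabOneSuffices :=
  stabOneSuffices_of_stubs stub_gluckPresentation stub_gluckOneStab

/-- BC3 letter: `<stub₁-sig> → <stub₂-sig> → StabOneSuffices` with the crux BY NAME (an `example`, so that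
`StabOneSuffices_of` stays the only by-name candidate the skeleton audit sees). -/
example :
    (∀ (M : Type) [TopologicalSpace M] [T2Space M] [SecondCountableTopology M]
      [ChartedSpace (EuclideanSpace ℝ (Fin 4)) M] [IsManifold (𝓡 4) ∞ M],
      ContinuousMap.HomotopyEquiv M S⁴ → ∃ K : TwoKnot, IsGluckTwist (𝓡 4) M K) →
    (∀ (K : TwoKnot) (X : Type) [TopologicalSpace X] [T2Space X] [SecondCountableTopology X]
      [ChartedSpace (EuclideanSpace ℝ (Fin 4)) X] [IsManifold (𝓡 4) ∞ X],
      IsGluckTwist (𝓡 4) X K →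
        ∃ (P : Type) (_ : TopologicalSpace P) (_ : ChartedSpace (EuclideanSpace ℝ (Fin 4)) P)
          (_ : IsManifold (𝓡 4) ∞ P),
          IsConnectedSum (𝓡 4) (𝓡 4) ((𝓡 2).prod (𝓡 2)) X (S² × S²) P ∧
            Nonempty (P ≃ₘ⟮𝓡 4, (𝓡 2).prod (𝓡 2)⟯ (S² × S²))) →
    Summit.SmoothPoincare4.SmoothPoincare4.Theses.ThreeFibres.StabOneSuffices :=
  stabOneSuffices_of_stubs

end Summit.SmoothPoincare4.SmoothPoincare4.Cruxes.StabOneSuffices.Birth
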